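import Summits.KontsevichZagierPeriods.KontsevichZagierPeriods.Theorems.SoloInformedAlgVertexGerm
import HarnessLib

/-!
# The DEN-calculus over `K`: the lower-chart lemma

Solo programme `solo-KontsevichZagierPeriods-informed`, session s107, step (x-h) of the general
two-dimensional algorithm: **the lower-chart lemma** `soloInformed_presentableDenK_blowLow`.

Let `F ∈ K[x₀, x₁]` vanish on the closed square only at `0`, with all monomials of degree `≥ m`,
and let `B = F_low = F(v₀, v₀v₁)/v₀^m` be its lower blow-up chart.  Suppose a finite set `T` of
real numbers of `K` contains every zero `t ∈ [0,1]` of `B(0, ·)`, and that every **child germ**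
`B(κ x₀, t + λ x₁)` (`t ∈ T`, `κ > 0`, `λ ≠ 0` in `K`) has the vertex-germ property.  Then
`xᵉ u · W · B` is a presentable denominator for every monomial `xᵉ u` and unit `W`.

Proof: the zeros of `B` on the closed square lie on the exceptional edge `v₀ = 0` at ordinates in
`T`; RULE ISOLATE (second coordinate, at the points of `T ∩ (0,1)` and at a point `z₀` below the
positive elements of `T`) cuts the square into strips on which the zeros of `B` are vertices;
on each strip LOCAL-GLOBAL applies with the leaf `L1` away from the zeros and the vertex packages
of `SoloInformedAlgVertexGerm` at the zeros (the extra cut at `z₀` guarantees that a strip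
touching the edge `x₁ = 0` has no zero at its far vertex, so that no factor `(1 − x₁)^k` appears
after reflection).

References: M. Kontsevich, D. Zagier, *Periods* (2001), §1.2; J. Kollár, *Lectures on Resolution
of Singularities* (2007), §1.10.
-/

noncomputable section

open scoped BigOperators
open MeasureTheory Set
open Literature.NumberTheory.Transcendental Literature.NumberTheory.Transcendental.KZ

namespace Summit.KontsevichZagierPeriods.KontsevichZagierPeriods.Theorems

variable {K : Type*} [Field K] [Algebra K ℝ]

/-- A point of the closed square with vanishing first coordinate is `(0, y₁)`. [this work] -/
theorem soloInformed_eq_vecCons_of_apply_zero {y : Fin 2 → ℝ} (hy : y 0 = 0) :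
    y = ![0, y 1] := by
  funext j
  fin_cases j
  · simpa using hy
  · simp

/-- The scale move of the second coordinate of the square as a vector. [this work] -/
theorem soloInformed_scaleMoveR_one_eq (a c : ℝ) (x : Fin 2 → ℝ) :
    soloInformedScaleMoveR 1 a c x = ![x 0, a + c * x 1] := by
  funext j
  fin_cases j <;> simp [soloInformedScaleMoveR]

/-- The zeros of `F_low` on the closed square lie on the exceptional edge, at the zeros of
`F_low(0, ·)`. [this work] -/
theorem soloInformed_blowLowK_zero_iff_edge (F : MvPolynomial (Fin 2) K) {m : ℕ}
    (hm : ∀ a ∈ F.support, m ≤ a 0 + a 1)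
    (hF : ∀ y ∈ soloInformedCube 2, y ≠ 0 → (MvPolynomial.aeval y F : ℝ) ≠ 0)
    {v : Fin 2 → ℝ} (hv : v ∈ soloInformedCube 2)
    (h0 : (MvPolynomial.aeval v (soloInformedBlowLowK F m) : ℝ) = 0) :
    v 0 = 0 ∧ (MvPolynomial.aeval ![0, v 1] (soloInformedBlowLowK F m) : ℝ) = 0 := by
  have hv0 : v 0 = 0 := by
    rcases eq_or_lt_of_le (hv 0).1 with h | h
    · exact h.symm
    · exact absurd h0 (soloInformed_aeval_blowLowK_ne_zero F hm hF hv h)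
  exact ⟨hv0, by rw [← soloInformed_eq_vecCons_of_apply_zero hv0]; exact h0⟩

/-- **The lower-chart lemma.**  See the module docstring. [this work] -/
theorem soloInformed_presentableDenK_blowLow
    (hK : ∀ c : K, IsAlgebraic ℚ (algebraMap K ℝ c)) {F : MvPolynomial (Fin 2) K} {m : ℕ}
    (hm : ∀ a ∈ F.support, m ≤ a 0 + a 1)
    (hF : ∀ y ∈ soloInformedCube 2, y ≠ 0 → (MvPolynomial.aeval y F : ℝ) ≠ 0)
    (T : Finset ℝ) (hTK : ∀ t ∈ T, ∃ c : K, algebraMap K ℝ c = t)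
    (hT : ∀ t : ℝ, 0 ≤ t → t ≤ 1 →
      (MvPolynomial.aeval ![0, t] (soloInformedBlowLowK F m) : ℝ) = 0 → t ∈ T)
    (hchild : ∀ t : K, algebraMap K ℝ t ∈ T → ∀ κ lam : K, 0 < algebraMap K ℝ κ →
      algebraMap K ℝ lam ≠ 0 → SoloInformedVertexGermOK (soloInformedChildK F m t κ lam))
    (e : Fin 2 →₀ ℕ) {u : K} (hu : u ≠ 0) {W : MvPolynomial (Fin 2) K}
    (hW : ∀ y ∈ soloInformedCube 2, (MvPolynomial.aeval y W : ℝ) ≠ 0) :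
    SoloInformedPresentableDenK
      (MvPolynomial.monomial e u * (W * soloInformedBlowLowK F m)) := by
  classical
  set B := soloInformedBlowLowK F m with hBdef
  have hinj : Function.Injective (algebraMap K ℝ) := (algebraMap K ℝ).injective
  -- zeros of `B` on the closed square
  have hBz : ∀ v ∈ soloInformedCube 2, (MvPolynomial.aeval v B : ℝ) = 0 → v 0 = 0 ∧ v 1 ∈ T :=
    fun v hv h0 => by
    obtain ⟨hv0, he⟩ := soloInformed_blowLowK_zero_iff_edge F hm hF hv h0
    exact ⟨hv0, hT _ (hv 1).1 (hv 1).2 he⟩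
  have hBopen : ∀ x ∈ soloInformedOpenCube 2, (MvPolynomial.aeval x B : ℝ) ≠ 0 := fun x hx =>
    soloInformed_aeval_blowLowK_ne_zero F hm hF (soloInformedOpenCube_subset_cube 2 hx) (hx 0).1
  -- a point `z₀ = 1/(M+1)` below the positive elements of `T`
  obtain ⟨η, hη, hη1, hgap⟩ := soloInformed_exists_pos_lt_of_finite T.finite_toSet
  obtain ⟨M, hM⟩ := exists_nat_one_div_lt hη
  set z₀ : ℝ := 1 / ((M : ℝ) + 1) with hz₀
  have hz₀pos : 0 < z₀ := by positivity
  have hz₀T : ∀ t ∈ T, 0 < t → z₀ < t := fun t ht ht0 => hM.trans (hgap t ht ht0)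
  -- the cut set
  set Z : Finset ℝ := insert z₀ (T.filter fun t => 0 < t ∧ t < 1) with hZ
  have hZK : ∀ z ∈ Z, ∃ c : K, algebraMap K ℝ c = z := by
    intro z hz
    rcases Finset.mem_insert.1 hz with rfl | hz
    · refine ⟨((M + 1 : ℕ) : K)⁻¹, ?_⟩
      rw [map_inv₀, map_natCast, hz₀, one_div]; push_cast; rfl
    · exact hTK z (Finset.mem_filter.1 hz).1
  have hZ01 : ∀ z ∈ Z, 0 < z ∧ z < 1 := by
    intro z hz
    rcases Finset.mem_insert.1 hz with rfl | hz
    · exact ⟨hz₀pos, hM.trans_le hη1⟩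
    · exact (Finset.mem_filter.1 hz).2
  have hQ : ∀ x ∈ soloInformedOpenCube 2,
      (MvPolynomial.aeval x (MvPolynomial.monomial e u * (W * B)) : ℝ) ≠ 0 := fun x hx => by
    rw [map_mul, map_mul, soloInformed_aevalK_monomial]
    exact mul_ne_zero (mul_ne_zero ((map_ne_zero _).2 hu)
      (Finset.prod_ne_zero_iff.2 fun j _ => pow_ne_zero _ (hx j).1.ne'))
      (mul_ne_zero (hW x (soloInformedOpenCube_subset_cube 2 hx)) (hBopen x hx))
  refine soloInformed_presentableDenK_of_isolate hK 1 Z hZK hZ01 hQ fun α β h0a hab hb1 hZab => ?_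
  -- one strip `x₁ ∈ [a, b]`
  set a := algebraMap K ℝ α with ha
  set b := algebraMap K ℝ β with hb
  have hba : 0 < b - a := sub_pos.2 hab
  have hmap : algebraMap K ℝ (β - α) = b - a := by rw [map_sub]
  -- no element of `T` strictly inside `(a, b)`, and `z₀ ∉ (a, b)`
  have hTab : ∀ t ∈ T, a < t → t < b → False := fun t ht hat htb => by
    have htZ : t ∈ Z := Finset.mem_insert_of_mem
      (Finset.mem_filter.2 ⟨ht, lt_of_le_of_lt h0a hat, lt_of_lt_of_le htb hb1⟩)
    rcases hZab t htZ with h | h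
    · exact absurd hat (not_lt.2 h)
    · exact absurd htb (not_lt.2 h)
  have hz₀ab : z₀ ≤ a ∨ b ≤ z₀ := hZab z₀ (Finset.mem_insert_self _ _)
  -- the strip data
  set W' := soloInformedScaleSubstK 1 α (β - α) W with hW'
  set B' := soloInformedScaleSubstK 1 α (β - α) B with hB'
  have hmv_mem : ∀ y ∈ soloInformedCube 2, soloInformedScaleMoveR 1 a (b - a) y ∈ soloInformedCube 2 :=
    fun y hy j => by
    by_cases hj : j = 1
    · subst hj
      rw [soloInformed_scaleMoveR_apply_self]
      refine ⟨add_nonneg h0a (mul_nonneg hba.le (hy 1).1), ?_⟩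
      nlinarith [(hy 1).2, hba]
    · rw [soloInformed_scaleMoveR_apply_ne 1 a (b - a) y hj]; exact hy j
  have hW'u : ∀ y ∈ soloInformedCube 2, (MvPolynomial.aeval y W' : ℝ) ≠ 0 := fun y hy => by
    rw [hW', soloInformed_aeval_scaleSubstK, hmap]
    exact hW _ (hmv_mem y hy)
  have hB'val : ∀ y : Fin 2 → ℝ, (MvPolynomial.aeval y B' : ℝ) =
      MvPolynomial.aeval ![y 0, a + (b - a) * y 1] B := fun y => by
    rw [hB', soloInformed_aeval_scaleSubstK, hmap, soloInformed_scaleMoveR_one_eq]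
  -- KEY: zeros of `B'` on the closed square
  have hkey : ∀ y ∈ soloInformedCube 2, (MvPolynomial.aeval y B' : ℝ) = 0 →
      y 0 = 0 ∧ a + (b - a) * y 1 ∈ T ∧ (y 1 = 0 ∨ y 1 = 1) := fun y hy h0 => by
    rw [hB'val, ← soloInformed_scaleMoveR_one_eq] at h0
    obtain ⟨h00, h1T⟩ := hBz _ (hmv_mem y hy) h0
    rw [soloInformed_scaleMoveR_apply_ne 1 a (b - a) y (by decide)] at h00
    rw [soloInformed_scaleMoveR_apply_self] at h1T
    refine ⟨h00, h1T, ?_⟩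
    have hs_lo : a ≤ a + (b - a) * y 1 := le_add_of_nonneg_right (mul_nonneg hba.le (hy 1).1)
    have hs_hi : a + (b - a) * y 1 ≤ b := by nlinarith [(hy 1).2, hba]
    rcases eq_or_lt_of_le hs_lo with h | h
    · left; nlinarith [hba]
    · rcases eq_or_lt_of_le hs_hi with h' | h'
      · right; nlinarith [hba]
      · exact (hTab _ h1T h h').elim
  have hB'open : ∀ x ∈ soloInformedOpenCube 2, (MvPolynomial.aeval x B' : ℝ) ≠ 0 := fun x hx h0 =>
    (hx 0).1.ne' (hkey x (soloInformedOpenCube_subset_cube 2 hx) h0).1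
  -- values of the strip polynomial
  have hval : ∀ x : Fin 2 → ℝ, (MvPolynomial.aeval x
      (soloInformedScaleSubstK 1 α (β - α) (MvPolynomial.monomial e u * (W * B))) : ℝ) =
      algebraMap K ℝ u * (x 0 ^ e 0 * (a + (b - a) * x 1) ^ e 1) *
        (MvPolynomial.aeval x W' * MvPolynomial.aeval x B') := fun x => by
    rw [map_mul, map_mul, map_mul, map_mul, soloInformed_aeval_scaleSubstK, hmap,
      soloInformed_aevalK_monomial, Fin.prod_univ_two, soloInformed_scaleMoveR_apply_self,
      soloInformed_scaleMoveR_apply_ne 1 a (b - a) x (by decide)]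
  rcases eq_or_lt_of_le h0a with h0a' | h0a'
  · ----------------------------------------------------------------
    -- CASE `a = 0`: the strip touches the edge `x₁ = 0`; the only possible zero of `B'` is `0`
    have ha0 : a = 0 := h0a'.symm
    have hB'z : ∀ y ∈ soloInformedCube 2, (MvPolynomial.aeval y B' : ℝ) = 0 → y = 0 ∧ (0 : ℝ) ∈ T :=
      fun y hy h0 => by
      obtain ⟨hy0, hsT, hy1⟩ := hkey y hy h0
      rcases hy1 with hy1 | hy1
      · rw [hy1, mul_zero, add_zero, ha0] at hsT
        exact ⟨by funext j; fin_cases j <;> simp [hy0, hy1], hsT⟩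
      · exfalso
        rw [hy1, mul_one, add_sub_cancel] at hsT
        have hb0 : 0 < b := by rw [← ha0]; exact hab
        rcases hz₀ab with h | h
        · exact absurd (h.trans_eq ha0) (not_le.2 hz₀pos)
        · exact absurd (hz₀T b hsT hb0) (not_lt.2 h)
    by_cases hT0 : (0 : ℝ) ∈ T
    · -- the child germ at `t = 0`, scales `κ = 1`, `λ = β`
      have hb0 : b ≠ 0 := by rw [← ha0]; exact hab.ne'
      have hP := hchild 0 (by rw [map_zero]; exact hT0) 1 β (by rw [map_one]; exact one_pos)
        (by rw [← hb]; exact hb0)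
      have hchval : ∀ y : Fin 2 → ℝ, (MvPolynomial.aeval y (soloInformedChildK F m 0 1 β) : ℝ) =
          MvPolynomial.aeval y B' := fun y => by
        rw [soloInformed_aeval_childK, hB'val, map_zero, map_one, ← hb, ha0, one_mul, zero_add,
          zero_add, sub_zero]
      have hiso : ∀ y ∈ soloInformedCube 2, y ≠ 0 →
          (MvPolynomial.aeval y (soloInformedChildK F m 0 1 β) : ℝ) ≠ 0 := fun y hy hy0 h0 => by
        rw [hchval] at h0
        exact hy0 (hB'z y hy h0).1
      have hU : ∀ y ∈ soloInformedCube 2,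
          (MvPolynomial.aeval y (MvPolynomial.C (β ^ e 1) * W') : ℝ) ≠ 0 := fun y hy => by
        rw [map_mul, MvPolynomial.aeval_C, map_pow]
        exact mul_ne_zero (pow_ne_zero _ (by rw [← hb]; exact hb0)) (hW'u y hy)
      refine soloInformed_presentableDenK_congr (fun x _ => ?_) (hP e u _ hu hU hiso)
      rw [hval, map_mul, map_mul, map_mul, soloInformed_aevalK_monomial, MvPolynomial.aeval_C,
        map_pow, hchval, Fin.prod_univ_two, ha0, zero_add, sub_zero, ← hb]
      ring
    · -- no zero at all: a leaf
      have hU : ∀ y ∈ soloInformedCube 2,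
          (MvPolynomial.aeval y (MvPolynomial.C (β ^ e 1) * (W' * B')) : ℝ) ≠ 0 := fun y hy => by
        rw [map_mul, map_mul, MvPolynomial.aeval_C, map_pow]
        refine mul_ne_zero (pow_ne_zero _ ?_) (mul_ne_zero (hW'u y hy) fun h0 => hT0 (hB'z y hy h0).2)
        rw [← hb, ← ha0]; exact hab.ne'
      refine soloInformed_presentableDenK_congr (fun x _ => ?_)
        (soloInformed_presentableDenK_monomial_mul_of_forall_ne_zero hK e hu hU)
      rw [hval, map_mul, map_mul, map_mul, soloInformed_aevalK_monomial, MvPolynomial.aeval_C,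
        map_pow, Fin.prod_univ_two, ha0, zero_add, sub_zero, ← hb]
      ring
  · ----------------------------------------------------------------
    -- CASE `a > 0`: the factor `(a + (b−a)x₁)^{e₁}` is a unit
    set Wpc : MvPolynomial (Fin 2) K :=
      (MvPolynomial.C α + MvPolynomial.C (β - α) * MvPolynomial.X 1) ^ e 1 * W' with hWpc
    have hWpcval : ∀ y : Fin 2 → ℝ, (MvPolynomial.aeval y Wpc : ℝ) =
        (a + (b - a) * y 1) ^ e 1 * MvPolynomial.aeval y W' := fun y => by
      rw [hWpc, map_mul, map_pow, map_add, map_mul, MvPolynomial.aeval_C, MvPolynomial.aeval_C,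
        MvPolynomial.aeval_X, hmap]
    have hlin : ∀ y ∈ soloInformedCube 2, 0 < a + (b - a) * y 1 := fun y hy =>
      lt_of_lt_of_le h0a' (le_add_of_nonneg_right (mul_nonneg hba.le (hy 1).1))
    have hWpcu : ∀ y ∈ soloInformedCube 2, (MvPolynomial.aeval y Wpc : ℝ) ≠ 0 := fun y hy => by
      rw [hWpcval]
      exact mul_ne_zero (pow_ne_zero _ (hlin y hy).ne') (hW'u y hy)
    set Mdl := MvPolynomial.monomial (Finsupp.single 0 (e 0)) u * (Wpc * B') with hMdl
    have hMdlval : ∀ x : Fin 2 → ℝ, (MvPolynomial.aeval x Mdl : ℝ) =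
        algebraMap K ℝ u * x 0 ^ e 0 * ((a + (b - a) * x 1) ^ e 1 * MvPolynomial.aeval x W' *
          MvPolynomial.aeval x B') := fun x => by
      rw [hMdl, map_mul, map_mul, soloInformed_aevalK_monomial, hWpcval, Fin.prod_univ_two]
      simp only [Finsupp.single_eq_same, Finsupp.single_eq_of_ne (show (1 : Fin 2) ≠ 0 by decide),
        pow_zero, mul_one]
    refine soloInformed_presentableDenK_congr (fun x _ => by rw [hval, hMdlval]; ring)
      (soloInformed_presentableDenK_of_locally_at_zeros hK (Q := Mdl) (fun x hx => ?_) fun p hp _ => ?_)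
    · rw [hMdlval]
      exact mul_ne_zero (mul_ne_zero ((map_ne_zero _).2 hu) (pow_ne_zero _ (hx 0).1.ne'))
        (mul_ne_zero (mul_ne_zero (pow_ne_zero _ (hlin x (soloInformedOpenCube_subset_cube 2 hx)).ne')
          (hW'u x (soloInformedOpenCube_subset_cube 2 hx))) (hB'open x hx))
    · -- local presentability at a zero `p` of the model
      by_cases hBp : (MvPolynomial.aeval p B' : ℝ) ≠ 0
      · exact soloInformed_locallyPresentableDenK_monomial_mul hK (Finsupp.single 0 (e 0)) hu
          (Wpc * B') (by rw [map_mul]; exact mul_ne_zero (hWpcu p hp) hBp)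
      · rw [not_not] at hBp
        obtain ⟨hp00, hsT, hp1⟩ := hkey p hp hBp
        -- zeros of `B'` with coordinates `< 1` : only `0`
        have hB'iso : ∀ y ∈ soloInformedCube 2, (∀ j, y j < 1) → y ≠ 0 →
            (MvPolynomial.aeval y B' : ℝ) ≠ 0 := fun y hy hlt hy0 h0 => by
          obtain ⟨hy0', -, hy1⟩ := hkey y hy h0
          rcases hy1 with hy1 | hy1
          · exact hy0 (by funext j; fin_cases j <;> simp [hy0', hy1])
          · exact absurd hy1 (hlt 1).ne
        rcases hp1 with hp1 | hp1
        · -- the vertex `0`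
          have hp_eq : p = 0 := by funext j; fin_cases j <;> simp [hp00, hp1]
          rw [hp1, mul_zero, add_zero] at hsT
          rw [hp_eq]
          refine soloInformed_locallyPresentableDenK_vertex_of_germOK hK (Finsupp.single 0 (e 0)) hu
            hWpcu hB'iso fun N hN => ?_
          have hN0 : (0 : ℝ) < N := by exact_mod_cast lt_trans zero_lt_one hN
          have hκ : 0 < algebraMap K ℝ ((N : K)⁻¹) := by
            rw [map_inv₀, map_natCast]; exact inv_pos.2 hN0
          have hlam : algebraMap K ℝ ((β - α) / N) ≠ 0 := by
            rw [map_div₀, map_natCast, hmap]; exact div_ne_zero hba.ne' hN0.ne'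
          have hchval : ∀ y : Fin 2 → ℝ,
              (MvPolynomial.aeval y (soloInformedChildK F m α (N : K)⁻¹ ((β - α) / N)) : ℝ) =
              MvPolynomial.aeval (fun j => y j / N) B' := fun y => by
            rw [soloInformed_aeval_childK, hB'val, map_inv₀, map_natCast, map_div₀, map_natCast,
              hmap, ← ha]
            have hpt : (![(N : ℝ)⁻¹ * y 0, a + (b - a) / N * y 1] : Fin 2 → ℝ) =
                ![y 0 / N, a + (b - a) * (y 1 / N)] := by
              funext j
              fin_cases j <;> simp <;> ring
            rw [hpt]
          refine ⟨_, hchild α hsT _ _ hκ hlam, fun y hy hy0 h0 => ?_, fun x _ => hchval x⟩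
          rw [hchval] at h0
          have hyN : (fun j => y j / (N : ℝ)) ∈ soloInformedCube 2 := fun j =>
            ⟨div_nonneg (hy j).1 hN0.le, (div_le_one hN0).2 ((hy j).2.trans (by exact_mod_cast hN.le))⟩
          have hlt : ∀ j, (fun j => y j / (N : ℝ)) j < 1 := fun j => by
            show y j / (N : ℝ) < 1
            rw [div_lt_one hN0]
            exact lt_of_le_of_lt (hy j).2 (by exact_mod_cast hN)
          refine hy0 ?_
          have h := hB'iso _ hyN hlt
          by_contra hne
          refine h (fun hzero => hne ?_) h0
          funext j
          have := congr_fun hzero j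
          simp only [Pi.zero_apply, div_eq_zero_iff, Nat.cast_eq_zero] at this
          rcases this with h' | h'
          · exact h'
          · exact absurd h' (lt_trans zero_lt_one hN).ne'
        · -- the vertex `(0, 1)`
          have hp_eq : p = ![0, 1] := by funext j; fin_cases j <;> simp [hp00, hp1]
          rw [hp1, mul_one, add_sub_cancel] at hsT
          rw [hp_eq]
          have hB'iso' : ∀ y ∈ soloInformedCube 2, (∀ j, y j < 1) → y ≠ 0 →
              (MvPolynomial.aeval (soloInformedVertexMove ({1} : Finset (Fin 2)) y) B' : ℝ) ≠ 0 :=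
            fun y hy hlt hy0 h0 => by
            obtain ⟨hy0', -, hy1⟩ := hkey _ (soloInformed_vertexMove_mem_closedCube _ hy) h0
            simp only [soloInformedVertexMove, Finset.mem_singleton] at hy0' hy1
            simp only [show ((0 : Fin 2) = 1) = False by decide, if_false, if_true] at hy0' hy1
            rcases hy1 with hy1 | hy1
            · exact absurd (by linarith : y 1 = 1) (hlt 1).ne
            · exact hy0 (by funext j; fin_cases j <;> simp [hy0'] ; linarith)
          refine soloInformed_locallyPresentableDenK_vertex01_of_germOK hK (e 0) hu hWpcu hB'open
            hB'iso' fun N hN => ?_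
          have hN0 : (0 : ℝ) < N := by exact_mod_cast lt_trans zero_lt_one hN
          have hκ : 0 < algebraMap K ℝ ((N : K)⁻¹) := by
            rw [map_inv₀, map_natCast]; exact inv_pos.2 hN0
          have hlam : algebraMap K ℝ (-((β - α) / N)) ≠ 0 := by
            rw [map_neg, map_div₀, map_natCast, hmap]
            exact neg_ne_zero.2 (div_ne_zero hba.ne' hN0.ne')
          have hchval : ∀ y : Fin 2 → ℝ,
              (MvPolynomial.aeval y (soloInformedChildK F m β (N : K)⁻¹ (-((β - α) / N))) : ℝ) =
              MvPolynomial.aeval (soloInformedVertexMove ({1} : Finset (Fin 2))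
                (fun j => y j / N)) B' := fun y => by
            rw [soloInformed_aeval_childK, hB'val, map_inv₀, map_natCast, map_neg, map_div₀,
              map_natCast, hmap, ← hb]
            have hpt : (![(N : ℝ)⁻¹ * y 0, b + -((b - a) / N) * y 1] : Fin 2 → ℝ) =
                ![soloInformedVertexMove ({1} : Finset (Fin 2)) (fun j => y j / ↑N) 0,
                  a + (b - a) * soloInformedVertexMove ({1} : Finset (Fin 2)) (fun j => y j / ↑N) 1] := by
              funext j
              fin_cases j <;> simp [soloInformedVertexMove] <;> ring
            rw [hpt]
          refine ⟨_, hchild β hsT _ _ hκ hlam, fun y hy hy0 h0 => ?_, fun x _ => hchval x⟩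
          rw [hchval] at h0
          have hyN : (fun j => y j / (N : ℝ)) ∈ soloInformedCube 2 := fun j =>
            ⟨div_nonneg (hy j).1 hN0.le, (div_le_one hN0).2 ((hy j).2.trans (by exact_mod_cast hN.le))⟩
          have hlt : ∀ j, (fun j => y j / (N : ℝ)) j < 1 := fun j => by
            show y j / (N : ℝ) < 1
            rw [div_lt_one hN0]
            exact lt_of_le_of_lt (hy j).2 (by exact_mod_cast hN)
          refine hy0 ?_
          have h := hB'iso' _ hyN hlt
          by_contra hne
          refine h (fun hzero => hne ?_) h0
          funext j
          have := congr_fun hzero j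
          simp only [Pi.zero_apply, div_eq_zero_iff, Nat.cast_eq_zero] at this
          rcases this with h' | h'
          · exact h'
          · exact absurd h' (lt_trans zero_lt_one hN).ne'

end Summit.KontsevichZagierPeriods.KontsevichZagierPeriods.Theorems
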